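import Summits.QuantumFields.YangMills.Theorems.BalabanUVNodesK1EndExactRowsStrictInBox

/-!
# ROW (i) OF K1⁹ IS NOT NEEDED FOR THE END EITHER — THE POSITIVE-KICK WITNESS: END, (W), (T), row (iv), no-shrink and (C) at EVERY level, while row (i) FAILS at every level

Cell `pub-ymgap`, seat `pub-ymgap-dag-n13-w4` (g8), N13 [B16] width seat 4∕4; `--kind proof --supports stmt-QuantumFields-27364 --as helper` (K1⁹
`…Theses.BalabanUVNodes.StabilityBRunRowsAtRecordR13SepCoPHV`, crux r3 DECIDING, route rev 29).  FILE 4 of this lineage's END-EXACTNESS census (FILE 2 = p626836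
`…K1EndExactRowsStrict`: the FIRST-KICK witness — END holds, rows (i), (iv) and no-shrink all FAIL; FILE 3 = p628067 `…K1EndExactRowsStrictInBox`: the FADING-KICK witness INSIDE the box
`[−1, 0]` — END + row (i) + (C) hold, row (iv) and no-shrink FAIL).  THIS FILE types the CONVERSE-SIDE witness the census lacked (ym-nodeO P3 memo v3.77 §23 (AV): «the surplus of K1⁹'s
rows over the END-exact letters {(W), (T), (C)} is (i) beyond (W) — sign-free, idle for the END — plus (iv) beyond (T)»): ONE history-dependent family for which the END, (W), (T), ROW (iv)
(floor `M = 0`), NO-SHRINK (every slack) and (C) hold AT EVERY LEVEL, and ROW (i) — the run-wise constant remainder `RunConstRemainder β b r γ` — FAILS AT EVERY LEVEL FOR EVERY `(b, r)`.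
With FILE 3 this gives `rowsI_IV_independent_over_END`: NEITHER pressed row of K1⁹ is necessary for K2⁹'s END, even given the other row and (C).

THE SHAPE (def-free; read through its two defining equations, as FILE 2 reads the first kick): `h0 : β 0 v = 1 ∕ (v 0)` — ONE asymptotic-freedom-signed kick at the first step,
UNBOUNDED ABOVE as `g_0 → 0⁺` — and `h1 : β k ≡ 0` for `k ≥ 1`.  Along a solution of (0.20) (`FlowStep.RGEqH`: `g_{k+1}⁻² = g_k⁻² − β_k`) the coupling is kicked UP once,
`g₁⁻² = g₀⁻² − g₀⁻¹`, and is constant afterwards; `β ≥ 0` on every box, so in-window runs are NON-DECREASING.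
* (W) by the explicit run `(a, a∕√(1−a), a∕√(1−a), …)` with `a := min ½ (γ∕2)` (`posKick_windowRuns`);
* row (iv) with `M = 0` at every level (`posKick_psFloor`), hence (T) at every level (FILE 2's `topRunThresholds_of_runwisePSFloor` BY NAME) and NO-SHRINK at every level for every slack
  `β₀ ≥ 0` (`posKick_noShrink`, from `posKick_run_mono`);
* box-continuity ⟹ (C) at every level; the END of `modelOf β` by file 12's ceiling-free road `endpointExistence_of_windowRuns_topRuns_betaContH` (p621368);
* row (i) FAILS: at the one-point run `(a)` of level `γ`, `|β 0 (a) − b 0| = |a⁻¹ − b 0| ≥ a⁻¹ − |b 0| > r` once `a ≤ (|b 0| + r + 1)⁻¹` (`posKick_not_runConstRemainder`).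

HONEST FRAMING.  [folklore] letter-level real analysis on the recursion (0.20) for an ABSTRACT `HBeta`; the witness is NOT inside a two-sided (1.22) box (`β 0` is unbounded above — the
K0-side `|β|` box p602861 is exactly what excludes it: row (i)'s END-idle surplus is paid by the box, never by the END); NOTHING about `Node00.betaOfRecord₁₃`; nothing of Bałaban asserted;
no item filed ∕ closed; K1⁹ NOT closed (0∕6 stubs); N13 NOT discharged; counts UNMOVED (typed 28∕28 · discharged 5∕27 · A 5∕28).  One finite 𝕋⁴ programme at fixed ε, Bałaban AS PRINTED;
R4 = the CONDITIONAL finite-𝕋⁴ rung `BalabanLadder.UV` only — the Yang–Mills mass gap (Clay) is NOT proved by any of this; nothing continuum ∕ ℝ⁴ ∕ OS.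
No `sorry`, no `axiom`, no `def`, no `instance`, no `notation`.
Sources (context only): [I] T. Bałaban, Commun. Math. Phys. 109 (1987) 249 [Balaban1987RG1] (0.17)–(0.20) pp. 255–256, Thm 2 p. 259 (first sentence), Thm 3 + (1.22) p. 264, §1 pp. 263–264,
(5.10) p. 293; [III] Commun. Math. Phys. 119 (1988) 243 [Balaban1988Convergent] (2.6) p. 255.
-/

noncomputable section

open scoped BigOperators Matrix.Norms.L2Operator

namespace Summit.QuantumFields.YangMills.Theorems.BalabanUVNodesK1EndExactRowsStrictPosKick

open Literature.MathematicalPhysics.QuantumFieldTheory.Balaban1983to89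
open Literature.MathematicalPhysics.QuantumFieldTheory.Balaban1983to89.FlowStep
open Literature.MathematicalPhysics.QuantumFieldTheory.Balaban1983to89.FlowStepRuns
open Literature.MathematicalPhysics.QuantumFieldTheory.Balaban1983to89.DagBinding
open Summit.QuantumFields.YangMills.Theorems.BalabanUVNodesK2NamedJetsRunRemAt (Survivors SurvCont RunConstRemainder)
open Summit.QuantumFields.YangMills.Theorems.BalabanUVNodesK1EndCriterionCeilingFree (endpointExistence_of_windowRuns_topRuns_betaContH)
open Summit.QuantumFields.YangMills.Theorems.BalabanUVNodesK1EndExactRowsStrict (topRunThresholds_of_runwisePSFloor)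
open Summit.QuantumFields.YangMills.Theorems.BalabanUVNodesK1EndExactRowsStrictInBox (exists_endpointExistence_rowI_cont_without_rowIV)

/-! ## §1 The positive-kick shape: sign, continuity, monotone runs -/

section PosKick

variable {β : HBeta}

/-- **THE POSITIVE-KICK SHAPE IS ASYMPTOTIC-FREEDOM SIGNED**: `0 ≤ β` on every box (floor `0`; the kick `1∕g_0 > 0`, the later steps `0`). [folklore] -/
theorem posKick_lower (h0 : ∀ v : Fin (0 + 1) → ℝ, β 0 v = 1 / v 0) (h1 : ∀ k : ℕ, k ≠ 0 → ∀ v : Fin (k + 1) → ℝ, β k v = 0) (γ : ℝ) :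
    BetaLowerH 0 γ β := by
  intro k v hv
  by_cases hk : k = 0
  · subst hk
    rw [h0]
    exact (one_div_pos.mpr ((mem_box.mp hv) 0).1).le
  · exact (h1 k hk v).ge

/-- the positive-kick shape is box-continuous at every level ([I] §1 pp.263–264's letter, here trivially). [folklore] -/
theorem posKick_cont (h0 : ∀ v : Fin (0 + 1) → ℝ, β 0 v = 1 / v 0) (h1 : ∀ k : ℕ, k ≠ 0 → ∀ v : Fin (k + 1) → ℝ, β k v = 0) (γ : ℝ) :
    BetaContH γ β := by
  intro k
  by_cases hk : k = 0
  · subst hk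
    have hc : ContinuousOn (fun v : Fin (0 + 1) → ℝ => 1 / v 0) (Box γ 0) :=
      continuousOn_const.div (continuous_apply 0).continuousOn fun v hv => ((mem_box.mp hv) 0).1.ne'
    exact hc.congr fun v _ => h0 v
  · exact continuousOn_const.congr fun v _ => h1 k hk v

/-- hence run-wise (C) `SurvCont` at every level `γ₀ > 0` (DEF-1's letter; `SurvCont.of_betaContH`). [folklore] -/
theorem posKick_survCont (h0 : ∀ v : Fin (0 + 1) → ℝ, β 0 v = 1 / v 0) (h1 : ∀ k : ℕ, k ≠ 0 → ∀ v : Fin (k + 1) → ℝ, β k v = 0) {γ₀ : ℝ} (hγ₀ : 0 < γ₀) :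
    SurvCont β γ₀ :=
  SurvCont.of_betaContH hγ₀ (posKick_cont h0 h1 γ₀)

/-- **IN-WINDOW RUNS OF A FLOOR-`0` FAMILY ARE NON-DECREASING**: along a solution of (0.20) with positive entries, `0 ≤ β_j` at every prefix gives `g_j⁻² ≥ g_{j+1}⁻²`, i.e. `g_j ≤ g_{j+1}`;
hence `g_m ≤ g_{n′}` for `m ≤ n′ ≤ n`.  Stated for any `β` with `0 ≤ β` on the box of the run's level (FILE 3's `run_le_start_of_nonpos` is the mirror statement). [folklore] -/
theorem run_mono_of_nonneg {γ : ℝ} (hlo : BetaLowerH 0 γ β) {n : ℕ} {gs : ℕ → ℝ} (hrg : RGEqH n β gs) (hI : Step.InInterval γ n gs) :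
    ∀ m n', m ≤ n' → n' ≤ n → gs m ≤ gs n' := by
  have hstep : ∀ j, j < n → gs j ≤ gs (j + 1) := by
    intro j hj
    have hj0 : 0 < gs j := (hI j hj.le).1
    have hj1 : 0 < gs (j + 1) := (hI (j + 1) hj).1
    have hmem : prefixOf gs j ∈ Box γ j := mem_box.mpr fun i => by
      rw [prefixOf_apply]; exact hI i (le_trans (Nat.lt_succ_iff.mp i.isLt) hj.le)
    have h1 : 1 / (gs (j + 1)) ^ 2 ≤ 1 / (gs j) ^ 2 := by linarith [hrg j hj, hlo j (prefixOf gs j) hmem]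
    have := (one_div_le_one_div (by positivity) (by positivity)).1 h1
    exact (pow_le_pow_iff_left₀ hj0.le hj1.le two_ne_zero).1 this
  intro m n' hmn hn'
  induction n' with
  | zero => rw [Nat.le_zero.mp hmn]
  | succ n' ih =>
    rcases Nat.lt_or_eq_of_le hmn with hlt | heq
    · exact (ih (Nat.lt_succ_iff.mp hlt) (Nat.le_of_succ_le hn')).trans (hstep n' (Nat.lt_of_succ_le hn'))
    · rw [heq]

/-- the positive-kick shape's in-window runs are non-decreasing (every level). [folklore] -/
theorem posKick_run_mono (h0 : ∀ v : Fin (0 + 1) → ℝ, β 0 v = 1 / v 0) (h1 : ∀ k : ℕ, k ≠ 0 → ∀ v : Fin (k + 1) → ℝ, β k v = 0) {γ : ℝ} {n : ℕ} {gs : ℕ → ℝ}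
    (hrg : RGEqH n β gs) (hI : Step.InInterval γ n gs) : ∀ m n', m ≤ n' → n' ≤ n → gs m ≤ gs n' :=
  run_mono_of_nonneg (posKick_lower h0 h1 γ) hrg hI

/-! ## §2 The rows that HOLD at every level: (iv) with `M = 0`, no-shrink for every slack, (T), (W); and the END -/

/-- **ROW (iv) AT EVERY LEVEL with the constant `M = 0`**: the partial sums of a floor-`0` family along in-window runs are `≥ 0`. [cite: Balaban1987RG1, (0.20) p.256; Balaban1988Convergent, (2.6) p.255 (the letter; elementary)] -/
theorem posKick_psFloor (h0 : ∀ v : Fin (0 + 1) → ℝ, β 0 v = 1 / v 0) (h1 : ∀ k : ℕ, k ≠ 0 → ∀ v : Fin (k + 1) → ℝ, β k v = 0) (γ : ℝ) :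
    ∀ (n : ℕ) (gs : ℕ → ℝ), RGEqH n β gs → Step.InInterval γ n gs → ∀ k, k ≤ n → -(0 : ℝ) ≤ ∑ j ∈ Finset.Ico k n, β j (prefixOf gs j) := by
  intro n gs _ hI k _
  rw [neg_zero]
  refine Finset.sum_nonneg fun j hj => posKick_lower h0 h1 γ j (prefixOf gs j) (mem_box.mpr fun i => ?_)
  rw [prefixOf_apply]
  exact hI i (le_trans (Nat.lt_succ_iff.mp i.isLt) (Finset.mem_Ico.mp hj).2.le)

/-- **NO-(1+β₀)⁻¹-SHRINK AT EVERY LEVEL FOR EVERY SLACK `β₀ ≥ 0`** ([III] (2.6)'s last member along runs): immediate from monotone runs. [cite: Balaban1988Convergent, (2.6) p.255 (the letter; elementary)] -/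
theorem posKick_noShrink (h0 : ∀ v : Fin (0 + 1) → ℝ, β 0 v = 1 / v 0) (h1 : ∀ k : ℕ, k ≠ 0 → ∀ v : Fin (k + 1) → ℝ, β k v = 0) (γ : ℝ) {β₀ : ℝ} (hβ₀ : 0 ≤ β₀) :
    ∀ (n : ℕ) (gs : ℕ → ℝ), RGEqH n β gs → Step.InInterval γ n gs → ∀ m n', m < n' → n' ≤ n → gs m ≤ (1 + β₀) * gs n' := by
  intro n gs hrg hI m n' hmn hn'
  have hle := posKick_run_mono h0 h1 hrg hI m n' hmn.le hn'
  have hpos : 0 < gs n' := (hI n' hn').1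
  nlinarith

/-- **(T) AT EVERY LEVEL** — row (iv) with `M = 0` at level `γ` gives the top-run threshold at `γ` (FILE 2's `topRunThresholds_of_runwisePSFloor` BY NAME; here even `g⋆(γ) = γ`: a non-decreasing
in-]0,γ] run that visits `γ` ends at `γ`). [cite: Balaban1987RG1, (0.20) p.256, Thm 2 p.259 (first sentence) (elementary)] -/
theorem posKick_topRuns (h0 : ∀ v : Fin (0 + 1) → ℝ, β 0 v = 1 / v 0) (h1 : ∀ k : ℕ, k ≠ 0 → ∀ v : Fin (k + 1) → ℝ, β k v = 0) {γ : ℝ} (hγ : 0 < γ) :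
    ∃ gstar : ℝ, 0 < gstar ∧ ∀ (n : ℕ) (gs : ℕ → ℝ), RGEqH n β gs → Step.InInterval γ n gs → ∀ k, k ≤ n → gs k = γ → gstar ≤ gs n :=
  topRunThresholds_of_runwisePSFloor β hγ (posKick_psFloor h0 h1 γ) γ hγ le_rfl

/-- **(W) AT EVERY LEVEL — RUNS OF EVERY LENGTH IN EVERY WINDOW, BY AN EXPLICIT RUN**: for `0 < γ` put `a := min ½ (γ∕2)` and `a′ := a ∕ √(1 − a)`; the sequence `(a, a′, a′, …)` solves
(0.20) for the positive kick (`a′⁻² = (1 − a)∕a² = a⁻² − a⁻¹`, then `β ≡ 0`) and stays in `]0, γ]` (`√(1−a) ≥ ½`, so `a′ ≤ 2a ≤ γ`).  No ceiling is available (`β 0` is unbounded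
above), so file 12's `windowRuns_of_betaUpperH` does not apply — the run is written down. [cite: Balaban1987RG1, (0.17)–(0.20) pp.255–256 (the recursion only; elementary)] -/
theorem posKick_windowRuns (h0 : ∀ v : Fin (0 + 1) → ℝ, β 0 v = 1 / v 0) (h1 : ∀ k : ℕ, k ≠ 0 → ∀ v : Fin (k + 1) → ℝ, β k v = 0) (γ₀ : ℝ) :
    ∀ γ : ℝ, 0 < γ → γ ≤ γ₀ → ∀ K : ℕ, ∃ gs : ℕ → ℝ, RGEqH K β gs ∧ Step.InInterval γ K gs := by
  intro γ hγ _ K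
  set a : ℝ := min (1 / 2) (γ / 2) with ha_def
  have ha : 0 < a := lt_min one_half_pos (half_pos hγ)
  have ha2 : a ≤ 1 / 2 := min_le_left _ _
  have haγ : a ≤ γ / 2 := min_le_right _ _
  have h1a : 0 < 1 - a := by linarith
  set s : ℝ := Real.sqrt (1 - a) with hs_def
  have hs : 0 < s := Real.sqrt_pos.mpr h1a
  have hs2 : s ^ 2 = 1 - a := Real.sq_sqrt h1a.le
  have hs_half : 1 / 2 ≤ s := by
    rw [hs_def]
    refine Real.le_sqrt_of_sq_le ?_
    nlinarith
  set a' : ℝ := a / s with ha'_def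
  have ha' : 0 < a' := div_pos ha hs
  have ha'le : a' ≤ γ := by
    have h2a : a' ≤ a / (1 / 2) := div_le_div_of_nonneg_left ha.le one_half_pos hs_half
    have : a / (1 / 2) = 2 * a := by ring
    linarith
  -- the explicit run
  set gs : ℕ → ℝ := fun j => if j = 0 then a else a' with hgs
  have hg0 : gs 0 = a := by simp [hgs]
  have hgS : ∀ j : ℕ, gs (j + 1) = a' := fun j => by simp [hgs]
  refine ⟨gs, fun k hk => ?_, fun j _ => ?_⟩
  · rcases Nat.eq_zero_or_pos k with rfl | hkpos
    · have hβ : β 0 (prefixOf gs 0) = 1 / a := by rw [h0, prefixOf_apply]; simp [hg0]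
      rw [hβ, hg0, hgS 0, ha'_def, div_pow, one_div_div, hs2]
      field_simp
      ring
    · obtain ⟨k', rfl⟩ := Nat.exists_eq_succ_of_ne_zero (Nat.pos_iff_ne_zero.mp hkpos)
      rw [h1 (k' + 1) (Nat.succ_ne_zero k'), hgS k', hgS (k' + 1), add_zero]
  · rcases Nat.eq_zero_or_pos j with rfl | hjpos
    · rw [hg0]; exact ⟨ha, by linarith⟩
    · obtain ⟨j', rfl⟩ := Nat.exists_eq_succ_of_ne_zero (Nat.pos_iff_ne_zero.mp hjpos)
      rw [hgS j']; exact ⟨ha', ha'le⟩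

/-- ★ **THE POSITIVE-KICK SHAPE'S MODEL CONSTRUCTION HAS THE END**: `EndpointExistence (modelOf β)` — (W) and (T) at every level plus box continuity, through file 12's ceiling-free,
floor-free sufficiency road at the canonical forward-generated construction `modelOf β`.  So the END holds WITHOUT row (i) (next theorem). [cite: Balaban1987RG1, Thm 2 p.259 (first sentence), (0.17)–(0.20) pp.255–256 (elementary; nothing of the theorem asserted)] -/
theorem endpointExistence_modelOf_posKick (h0 : ∀ v : Fin (0 + 1) → ℝ, β 0 v = 1 / v 0) (h1 : ∀ k : ℕ, k ≠ 0 → ∀ v : Fin (k + 1) → ℝ, β k v = 0) :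
    EndpointExistence (modelOf β) :=
  endpointExistence_of_windowRuns_topRuns_betaContH (modelOf_forwardGenerated β) (γ₀ := 1) (γ' := 1) one_pos le_rfl (posKick_cont h0 h1 1)
    (posKick_windowRuns h0 h1 1) (fun _ hγ _ => posKick_topRuns h0 h1 hγ)

/-! ## §3 The row that FAILS: (i) at every level, for every reference sequence and radius -/

/-- **ROW (i) — THE RUN-WISE CONSTANT REMAINDER — FAILS AT EVERY LEVEL FOR EVERY `(b, r)`** for the positive kick: at the one-point run `(a)` of level `γ` (an (0.20)-solution up to `0`),
`|β 0 (a) − b 0| = |a⁻¹ − b 0| ≥ a⁻¹ − |b 0| > r` once `a ≤ min γ (|b 0| + r + 1)⁻¹`.  Row (i) asks `β` to stay within a FIXED radius of SOME sequence along all in-window runs — a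
boundedness letter near `g = 0` that the END never reads ((W) is its whole END-relevant content, and (W) holds here). [cite: Balaban1987RG1, Thm 3 p.264, (5.10) p.293 (the letter; elementary)] -/
theorem posKick_not_runConstRemainder (h0 : ∀ v : Fin (0 + 1) → ℝ, β 0 v = 1 / v 0) {γ : ℝ} (hγ : 0 < γ) (b : ℕ → ℝ) (r : ℝ) :
    ¬ RunConstRemainder β b r γ := by
  intro hrem
  set c : ℝ := |b 0| + r + 1 with hc_def
  by_cases hr : r < 0
  · have h := hrem 0 (fun _ => γ) (fun k hk => absurd hk (Nat.not_lt_zero k)) (fun _ _ => ⟨hγ, le_rfl⟩) 0 le_rfl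
    linarith [abs_nonneg (β 0 (prefixOf (fun _ => γ) 0) - b 0)]
  rw [not_lt] at hr
  have hc : 0 < c := by rw [hc_def]; positivity
  set a : ℝ := min γ (1 / c) with ha_def
  have ha : 0 < a := lt_min hγ (by positivity)
  have haγ : a ≤ γ := min_le_left _ _
  have hac : a ≤ 1 / c := min_le_right _ _
  have hRG : RGEqH 0 β (fun _ => a) := fun k hk => absurd hk (Nat.not_lt_zero k)
  have hI : Step.InInterval a 0 (fun _ => a) := fun _ _ => ⟨ha, le_rfl⟩
  have h := hrem.mono haγ 0 (fun _ => a) hRG hI 0 le_rfl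
  have hβ : β 0 (prefixOf (fun _ => a) 0) = 1 / a := by rw [h0]; simp [prefixOf_apply]
  rw [hβ] at h
  have hca : c ≤ 1 / a := by
    rw [le_div_iff₀ ha]
    calc c * a ≤ c * (1 / c) := mul_le_mul_of_nonneg_left hac hc.le
      _ = 1 := by field_simp
  have habs : 1 / a - |b 0| ≤ |1 / a - b 0| := by
    have := abs_sub_abs_le_abs_sub (1 / a) (b 0)
    rwa [abs_of_pos (one_div_pos.mpr ha)] at this
  have : c ≤ |b 0| + r := by linarith
  rw [hc_def] at this
  linarith

/-! ## §4 The displays: END ∧ (iv) ∧ (C) without (i); with FILE 3, rows (i) and (iv) are independent over the END -/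

/-- ★★ **THE END, (W), (T), ROW (iv), NO-SHRINK AND (C) AT EVERY LEVEL — WITHOUT ROW (i) AT ANY LEVEL — KERNEL WITNESS.**  One history-dependent family `β` (the positive kick, instantiated
here once) with the FLOOR `0` on every box, box-continuity at every level, run-wise (C) at every level, (W) runs of every length in every window, (T) a top-run threshold at every level,
ROW (iv) with `M = 0` at every level, NO-(1+β₀)⁻¹-SHRINK at every level for every `β₀ ≥ 0`, and `EndpointExistence (modelOf β)` — for which ROW (i) `RunConstRemainder β b r γ` FAILS at
EVERY level for EVERY `(b, r)`.  The converse-side companion of FILE 3's ★★ `end_and_rowI_in_box_without_rowIV`.  HONEST SCOPE: NOT inside a two-sided (1.22) box (`β 0` unbounded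
above); at the route's `betaOfRecord₁₃ θ` NOTHING is claimed. [folklore] -/
theorem end_rowIV_noShrink_cont_without_rowI : ∃ β : HBeta,
    (∀ γ : ℝ, BetaLowerH 0 γ β) ∧ (∀ γ : ℝ, BetaContH γ β) ∧ (∀ γ₀ : ℝ, 0 < γ₀ → SurvCont β γ₀) ∧
    (∀ γ : ℝ, 0 < γ → ∀ K : ℕ, ∃ gs : ℕ → ℝ, RGEqH K β gs ∧ Step.InInterval γ K gs) ∧
    (∀ γ : ℝ, 0 < γ → ∃ gstar : ℝ, 0 < gstar ∧
      ∀ (n : ℕ) (gs : ℕ → ℝ), RGEqH n β gs → Step.InInterval γ n gs → ∀ k, k ≤ n → gs k = γ → gstar ≤ gs n) ∧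
    (∀ γ : ℝ, ∀ (n : ℕ) (gs : ℕ → ℝ), RGEqH n β gs → Step.InInterval γ n gs → ∀ k, k ≤ n → -(0 : ℝ) ≤ ∑ j ∈ Finset.Ico k n, β j (prefixOf gs j)) ∧
    (∀ γ β₀ : ℝ, 0 ≤ β₀ →
      ∀ (n : ℕ) (gs : ℕ → ℝ), RGEqH n β gs → Step.InInterval γ n gs → ∀ m n', m < n' → n' ≤ n → gs m ≤ (1 + β₀) * gs n') ∧
    EndpointExistence (modelOf β) ∧
    (∀ γ : ℝ, 0 < γ → ∀ (b : ℕ → ℝ) (r : ℝ), ¬ RunConstRemainder β b r γ) := by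
  have h0 : ∀ v : Fin (0 + 1) → ℝ, (fun k w => if k = 0 then 1 / w 0 else 0 : HBeta) 0 v = 1 / v 0 := fun v => if_pos rfl
  have h1 : ∀ k : ℕ, k ≠ 0 → ∀ v : Fin (k + 1) → ℝ, (fun k w => if k = 0 then 1 / w 0 else 0 : HBeta) k v = 0 := fun k hk v => if_neg hk
  exact ⟨fun k w => if k = 0 then 1 / w 0 else 0, posKick_lower h0 h1, posKick_cont h0 h1, fun _ hγ₀ => posKick_survCont h0 h1 hγ₀,
    fun γ hγ => posKick_windowRuns h0 h1 γ γ hγ le_rfl, fun _ hγ => posKick_topRuns h0 h1 hγ, fun γ => posKick_psFloor h0 h1 γ,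
    fun γ _ hβ₀ => posKick_noShrink h0 h1 γ hβ₀, endpointExistence_modelOf_posKick h0 h1, fun _ hγ b r => posKick_not_runConstRemainder h0 hγ b r⟩

/-- **COROLLARY — THE END DOES NOT PAY ROW (i), EVEN GIVEN ROW (iv) AND (C)**: there is a forward-generated, halting, currying construction WITH `EndpointExistence`, box-continuous floor-`0` β
(so (C) and row (iv) with `M = 0` at every level) whose β has row (i) at NO level.  The converse-side companion of FILE 3's `exists_endpointExistence_rowI_cont_without_rowIV`. [folklore] -/
theorem exists_endpointExistence_rowIV_cont_without_rowI : ∃ β : HBeta,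
    EndpointExistence (modelOf β) ∧ (∀ γ : ℝ, BetaLowerH 0 γ β) ∧ (∀ γ : ℝ, BetaContH γ β) ∧
    (∀ γ : ℝ, ∀ (n : ℕ) (gs : ℕ → ℝ), RGEqH n β gs → Step.InInterval γ n gs → ∀ k, k ≤ n → -(0 : ℝ) ≤ ∑ j ∈ Finset.Ico k n, β j (prefixOf gs j)) ∧
    (∀ γ : ℝ, 0 < γ → ∀ (b : ℕ → ℝ) (r : ℝ), ¬ RunConstRemainder β b r γ) := by
  obtain ⟨β, hlo, hcont, -, -, -, hps, -, hE, hrem⟩ := end_rowIV_noShrink_cont_without_rowI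
  exact ⟨β, hE, hlo, hcont, hps, hrem⟩

/-- ★★ **ROWS (i) AND (iv) OF K1⁹ ARE INDEPENDENT OVER THE END — THE SEPARATION TABLE OF THIS LINEAGE, COMPLETE BY NAME.**  (a) FILE 3 (p628067
`exists_endpointExistence_rowI_cont_without_rowIV`, BY NAME): a box-continuous family IN the box `[−1, 0]` with the END and row (i) at every level, for which row (iv) fails at every
level for every constant; (b) THIS FILE: a box-continuous floor-`0` family with the END and row (iv) (`M = 0`) at every level, for which row (i) fails at every level for every `(b, r)`.
Hence, as LETTERS on a general `HBeta`: NEITHER pressed row of K1⁹ is necessary for K2⁹'s END, even given the other row and (C); the END-relevant content of (i) is exactly (W) and of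
(iv) exactly (T) (file 12 ∕ p633163 §4: {(W), (T), (C)} is sufficient and, modulo (C) + non-crossing, necessary).  HONEST: letter level only; at `betaOfRecord₁₃ θ` nothing is claimed,
and the K0-side two-sided box — which print DOES assert ((1.22)) — restores row (i) there. [folklore] -/
theorem rowsI_IV_independent_over_END :
    (∃ β : HBeta, EndpointExistence (modelOf β) ∧ (∀ γ : ℝ, BetaLowerH (-1) γ β ∧ BetaUpperH 0 γ β) ∧ (∀ γ : ℝ, BetaContH γ β) ∧
      (∀ γ : ℝ, RunConstRemainder β (fun _ => -(1 / 2)) (1 / 2) γ) ∧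
      (∀ γ M : ℝ, 0 < γ →
        ¬ ∀ (n : ℕ) (gs : ℕ → ℝ), RGEqH n β gs → Step.InInterval γ n gs → ∀ k, k ≤ n → -M ≤ ∑ j ∈ Finset.Ico k n, β j (prefixOf gs j))) ∧
    (∃ β : HBeta, EndpointExistence (modelOf β) ∧ (∀ γ : ℝ, BetaLowerH 0 γ β) ∧ (∀ γ : ℝ, BetaContH γ β) ∧
      (∀ γ : ℝ, ∀ (n : ℕ) (gs : ℕ → ℝ), RGEqH n β gs → Step.InInterval γ n gs → ∀ k, k ≤ n → -(0 : ℝ) ≤ ∑ j ∈ Finset.Ico k n, β j (prefixOf gs j)) ∧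
      (∀ γ : ℝ, 0 < γ → ∀ (b : ℕ → ℝ) (r : ℝ), ¬ RunConstRemainder β b r γ)) :=
  ⟨exists_endpointExistence_rowI_cont_without_rowIV, exists_endpointExistence_rowIV_cont_without_rowI⟩

end PosKick

end Summit.QuantumFields.YangMills.Theorems.BalabanUVNodesK1EndExactRowsStrictPosKick

end
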